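import Literature.NumberTheory.Sieve.SmoothSharpMinorArcs
import Literature.NumberTheory.Sieve.SmoothTernaryHolderMult
import HarnessLib

/-!
# Minor arcs for sharp box-masked ternary friable trilinear forms (power denominators, multiplicity)

Topic `Literature/NumberTheory/Sieve`; a PROVED file ([Harper2016, Theorem 2 and §5, Proposition 5],
packaged).  The minor-arc part of the circle method for friable solutions of `d₁n₁ ± d₂n₂ = d₃n₃` with
`n₁, n₂` arbitrary bounded masks of `S(x₁,y)`, `S(x₂,y)` (e.g. class- and box-indicators) and `n₃` in a
SHARP BOX `S(X₃,y) ∖ S(X₃',y)` possibly restricted to a parity class, sampled at `N₀ = g₁N₁ = g₂N₂` points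
with dilations `d₁ = g₁d₁'`, `d₂ = g₂d₂'` (multiplicities `g₁, g₂`, as in
`ternary_holder_restriction_mult_of_eq`) and `d₃ ≥ 1` coprime to `N₀`, in the polylog regime
`y = ⌊(log x)^{100000}⌋`, all scales in `[x/(log x)^B, x]`, and denominator bound `R ≤ x^{1/10}`
(`SharpMinor.sharp_ternary_minor`):

`∑_{r minor} |V₁(d₁r/N₀)| |V₂(d₂r/N₀)| |V₃(d₃r/N₀)| ≤ C (log x)^{38} (d₃(log x)^B/R)^{49/200}`
`(g₁(1+N₁/x₁))^{2/5} (g₂(1+N₂/x₂))^{2/5} (1+N₀/X₃)^{1/5} 𝓟(x₁) 𝓟(x₂) 𝓟(X₃)`,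

`𝓟(Z) = Z^{α(Z,y)} ζ(α(Z,y),y)/√φ₂(α(Z,y),y)`: Hölder–restriction (`SmoothTernaryHolderMult`) with the
supremum of the third factor from `SmoothSharpMinorArcs` (`S₃ = C₁(log x)^{28}(d₃(log x)^B/R)^{49/100}𝓟(X₃)`).
With `R` a small power of `x` the factor `(d₃(log x)^B/R)^{49/200}` is a power saving.

## References

* A. J. Harper, *Minor arcs, mean values, and restriction theory for exponential sums over smooth numbers*,
  Compositio Math. 152 (2016) 1121–1158, Theorem 2 and §5, Proposition 5 [Harper2016].
-/

noncomputable section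

open Finset Filter Real
open scoped FourierTransform

namespace Literature.NumberTheory.Sieve

namespace SharpMinor

/-- A box-and-class indicator is a mask of modulus `≤ 1`, and the masked full sum is the box sum. [folklore] -/
theorem sum_indicator_mul_eq {S A : Finset ℕ} (hA : A ⊆ S) (f : ℕ → ℂ) :
    ∑ n ∈ S, (if n ∈ A then (1 : ℂ) else 0) * f n = ∑ n ∈ A, f n := by
  classical
  simp_rw [ite_mul, one_mul, zero_mul]
  rw [Finset.sum_ite_mem, Finset.inter_eq_right.2 hA]

/-- `(log x₁ log x₂ log x₃)^8 ≤ L^{24}` when `0 ≤ log x_i ≤ L`. [folklore] -/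
theorem log_prod_pow_le {a b c L : ℝ} (ha : 0 ≤ a) (hb : 0 ≤ b) (hc : 0 ≤ c) (haL : a ≤ L) (hbL : b ≤ L)
    (hcL : c ≤ L) : (a * b * c) ^ (8 : ℕ) ≤ L ^ 24 := by
  have hL : 0 ≤ L := ha.trans haL
  have h : a * b * c ≤ L ^ 3 := by
    calc a * b * c ≤ L * L * L := by gcongr
      _ = L ^ 3 := by ring
  calc (a * b * c) ^ (8 : ℕ) ≤ (L ^ 3) ^ 8 := pow_le_pow_left₀ (by positivity) h 8
    _ = L ^ 24 := by rw [← pow_mul]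

/-- `𝓟^{1/2} (C₁ L^{28} F 𝓟)^{1/2} = √C₁ L^{14} F^{1/2} 𝓟` for `C₁, L, F, 𝓟 ≥ 0`, with `F = t^{49/100}`,
`F^{1/2} = t^{49/200}`. [folklore] -/
theorem sqrt_saving_eq {C₁ L t P : ℝ} (hC₁ : 0 ≤ C₁) (hL : 0 ≤ L) (ht : 0 ≤ t) (hP : 0 ≤ P) :
    P ^ (1 / 2 : ℝ) * (C₁ * L ^ 28 * t ^ (49 / 100 : ℝ) * P) ^ (1 / 2 : ℝ) =
      Real.sqrt C₁ * L ^ 14 * t ^ (49 / 200 : ℝ) * P := by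
  have hF : 0 ≤ t ^ (49 / 100 : ℝ) := Real.rpow_nonneg ht _
  have hL28 : 0 ≤ L ^ 28 := pow_nonneg hL _
  rw [Real.mul_rpow (by positivity) hP, Real.mul_rpow (by positivity) hF, Real.mul_rpow hC₁ hL28,
    ← Real.rpow_mul ht, Real.sqrt_eq_rpow,
    show L ^ 28 = (L ^ 14) ^ 2 by rw [← pow_mul],
    show ((L ^ 14) ^ 2) ^ (1 / 2 : ℝ) = L ^ 14 by
      rw [show (1 / 2 : ℝ) = ((2 : ℕ) : ℝ)⁻¹ by norm_num,
        Real.pow_rpow_inv_natCast (pow_nonneg hL _) (by norm_num)]]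
  have hPP : P ^ (1 / 2 : ℝ) * P ^ (1 / 2 : ℝ) = P := by
    rw [← Real.rpow_add' hP (by norm_num)]; norm_num
  calc P ^ (1 / 2 : ℝ) * (C₁ ^ (1 / 2 : ℝ) * L ^ 14 * t ^ (49 / 100 * (1 / 2 : ℝ)) * P ^ (1 / 2 : ℝ))
      = C₁ ^ (1 / 2 : ℝ) * L ^ 14 * t ^ (49 / 100 * (1 / 2 : ℝ)) * (P ^ (1 / 2 : ℝ) * P ^ (1 / 2 : ℝ)) := by
        ring
    _ = _ := by rw [hPP]; norm_num

set_option maxHeartbeats 1600000 in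
-- a long assembly with a large context
/-- **Minor arcs for SHARP box-masked ternary friable trilinear forms (power denominators, multiplicity).**
For every `B` there is `C` such that for all large `x` (`L = log x`, `y = ⌊L^{100000}⌋`,
`𝓟(Z) = Z^{α(Z,y)} ζ(α(Z,y),y)/√φ₂(α(Z,y),y)`): for all scales `x₁, x₂ ∈ [x/L^B, x]`, every third box
`x/L^B ≤ X₃' ≤ X₃ ≤ x` with an optional parity class (`m ∈ {1,2}`, class `c`), sample moduli
`N₀ = g₁N₁ = g₂N₂ ≥ 1`, dilations `d₁ = g₁d₁'`, `d₂ = g₂d₂'`, `d₃ ≥ 1` with `(d₁',N₁) = (d₂',N₂) = (d₃,N₀) = 1`,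
masks `|a₁|, |a₂| ≤ 1`, denominator bounds `4d₃L^B ≤ R ≤ x^{1/10}`, and every set `T ⊆ [0, N₀)` of MINOR
sample points (`|r/N₀ − a/q| > R/x` for all `1 ≤ q ≤ R`, `a ∈ ℤ`):
`∑_{r ∈ T} |V₁(d₁r/N₀)| |V₂(d₂r/N₀)| |∑_{n ∈ S(X₃)∖S(X₃'), n ≡ c (m)} e(n d₃ r/N₀)|`
`≤ C L^{38} (d₃L^B/R)^{49/200} (g₁(1+N₁/x₁))^{2/5} (g₂(1+N₂/x₂))^{2/5} (1+N₀/X₃)^{1/5} 𝓟(x₁) 𝓟(x₂) 𝓟(X₃)`,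
`V_i(θ) = ∑_{n ∈ S(x_i,y)} a_i(n) e(nθ)`.  Proof: `ternary_holder_restriction_mult_of_eq` (Hölder
`(5/2,5/2,5)` + oversampled restriction, [Harper2016, Thm 2]) at the real scales `x₁, x₂, X₃` (regime facts
from `polylog_regime_real_scales`) with the box-and-class indicator as third mask and
`S₃ = C₁ L^{28} (d₃L^B/R)^{49/100} 𝓟(X₃)` from `norm_boxExpSum_filter_le_of_minor` (Proposition 5);
`𝓟(X₃)^{1/2} S₃^{1/2} = √C₁ L^{14} (d₃L^B/R)^{49/200} 𝓟(X₃)` and `(log x₁ log x₂ log X₃)^8 ≤ L^{24}`.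
[cite: Harper2016, Theorem 2 and §5, Proposition 5] -/
theorem sharp_ternary_minor (B : ℕ) :
    ∃ C : ℝ, 0 < C ∧ ∀ᶠ x : ℝ in atTop, ∀ (x₁ x₂ X₃ X₃' : ℝ),
      x / Real.log x ^ B ≤ x₁ → x₁ ≤ x → x / Real.log x ^ B ≤ x₂ → x₂ ≤ x →
      x / Real.log x ^ B ≤ X₃' → X₃' ≤ X₃ → X₃ ≤ x →
      ∀ (N₀ : ℕ), 1 ≤ N₀ → ∀ (g₁ N₁ g₂ N₂ : ℕ), N₀ = g₁ * N₁ → N₀ = g₂ * N₂ →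
      ∀ (d₁ d₁' d₂ d₂' d₃ : ℤ), d₁ = g₁ * d₁' → IsCoprime d₁' (N₁ : ℤ) → d₂ = g₂ * d₂' →
      IsCoprime d₂' (N₂ : ℤ) → IsCoprime d₃ (N₀ : ℤ) → 1 ≤ d₃ →
      ∀ (a₁ a₂ : ℕ → ℂ), (∀ n, ‖a₁ n‖ ≤ 1) → (∀ n, ‖a₂ n‖ ≤ 1) →
      ∀ (m c : ℕ), (m = 1 ∨ m = 2) →
      ∀ R : ℝ, 4 * (d₃ : ℝ) * Real.log x ^ B ≤ R → R ≤ x ^ (1 / 10 : ℝ) →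
      ∀ (T : Finset ℕ), T ⊆ Finset.range N₀ →
      (∀ r ∈ T, ∀ q : ℕ, 1 ≤ q → (q : ℝ) ≤ R → ∀ a : ℤ, R / x < |(r : ℝ) / N₀ - a / q|) →
        ∑ r ∈ T,
          ‖∑ n ∈ Nat.smoothNumbersUpTo ⌊x₁⌋₊ (⌊Real.log x ^ 100000⌋₊ + 1),
              a₁ n * (𝐞 ((n : ℝ) * ((d₁ * r : ℝ) / N₀)) : ℂ)‖ *
          ‖∑ n ∈ Nat.smoothNumbersUpTo ⌊x₂⌋₊ (⌊Real.log x ^ 100000⌋₊ + 1),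
              a₂ n * (𝐞 ((n : ℝ) * ((d₂ * r : ℝ) / N₀)) : ℂ)‖ *
          ‖∑ n ∈ (Nat.smoothNumbersUpTo ⌊X₃⌋₊ (⌊Real.log x ^ 100000⌋₊ + 1) \
                Nat.smoothNumbersUpTo ⌊X₃'⌋₊ (⌊Real.log x ^ 100000⌋₊ + 1)).filter (fun n => n ≡ c [MOD m]),
              (𝐞 ((n : ℝ) * ((d₃ * r : ℝ) / N₀)) : ℂ)‖ ≤
        C * Real.log x ^ 38 * ((d₃ : ℝ) * Real.log x ^ B / R) ^ (49 / 200 : ℝ) *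
          ((g₁ : ℝ) * (1 + (N₁ : ℝ) / x₁)) ^ (2 / 5 : ℝ) * ((g₂ : ℝ) * (1 + (N₂ : ℝ) / x₂)) ^ (2 / 5 : ℝ) *
          (1 + (N₀ : ℝ) / X₃) ^ (1 / 5 : ℝ) *
          (x₁ ^ saddlePoint x₁ ⌊Real.log x ^ 100000⌋₊ *
            (smoothZeta (saddlePoint x₁ ⌊Real.log x ^ 100000⌋₊) ⌊Real.log x ^ 100000⌋₊ /
              Real.sqrt (saddlePhi₂ (saddlePoint x₁ ⌊Real.log x ^ 100000⌋₊) ⌊Real.log x ^ 100000⌋₊))) *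
          (x₂ ^ saddlePoint x₂ ⌊Real.log x ^ 100000⌋₊ *
            (smoothZeta (saddlePoint x₂ ⌊Real.log x ^ 100000⌋₊) ⌊Real.log x ^ 100000⌋₊ /
              Real.sqrt (saddlePhi₂ (saddlePoint x₂ ⌊Real.log x ^ 100000⌋₊) ⌊Real.log x ^ 100000⌋₊))) *
          (X₃ ^ saddlePoint X₃ ⌊Real.log x ^ 100000⌋₊ *
            (smoothZeta (saddlePoint X₃ ⌊Real.log x ^ 100000⌋₊) ⌊Real.log x ^ 100000⌋₊ /
              Real.sqrt (saddlePhi₂ (saddlePoint X₃ ⌊Real.log x ^ 100000⌋₊) ⌊Real.log x ^ 100000⌋₊))) := by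
  classical
  obtain ⟨C₁, hC₁, hM⟩ := norm_boxExpSum_filter_le_of_minor B
  obtain ⟨C₂, x₀, hC₂, hT⟩ := ternary_holder_restriction_mult_of_eq
  refine ⟨C₂ * Real.sqrt C₁, mul_pos hC₂ (Real.sqrt_pos.2 hC₁), ?_⟩
  filter_upwards [hM, polylog_regime_real_scales (max x₀ 1), polylog_regime_basic,
    SmoothArcs.eventually_log_pow_le_mul_rpow B (s := 1 / 2) (c := 1) (by norm_num) (by norm_num)]
    with x hMx hreg hbasic hE₁ x₁ x₂ X₃ X₃' hx₁ hx₁x hx₂ hx₂x hX₃' hX₃'X hX₃x N₀ hN₀ g₁ N₁ g₂ N₂ hgN₁ hgN₂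
    d₁ d₁' d₂ d₂' d₃ hd₁ hd₁' hd₂ hd₂' hd₃ hd₃1 a₁ a₂ ha₁ ha₂ m c hm R hR hRx T hTN hminor
  obtain ⟨hx1, hL2, -, -, -, -, -, -, -, -, -⟩ := hbasic
  set L : ℝ := Real.log x with hL
  set y : ℕ := ⌊L ^ 100000⌋₊ with hy
  have hx0 : 0 < x := by linarith
  have hL0 : 0 < L := by linarith
  have hLB0 : 0 < L ^ B := by positivity
  -- the scales are at least `√x`
  have hxx : x ^ (1 / 2 : ℝ) * x ^ (1 / 2 : ℝ) = x := by rw [← Real.rpow_add hx0]; norm_num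
  have hE₁' : x ^ (1 / 2 : ℝ) ≤ x / L ^ B := by
    rw [le_div_iff₀ hLB0]
    calc x ^ (1 / 2 : ℝ) * L ^ B ≤ x ^ (1 / 2 : ℝ) * (1 * x ^ (1 / 2 : ℝ)) := by gcongr
      _ = x := by rw [one_mul, hxx]
  obtain ⟨hz₁, h8₁, h6₁, h200₁, hα₁, hΨ₁, -, -⟩ := hreg x₁ (hE₁'.trans hx₁) hx₁x
  obtain ⟨hz₂, h8₂, h6₂, h200₂, hα₂, hΨ₂, -, -⟩ := hreg x₂ (hE₁'.trans hx₂) hx₂x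
  obtain ⟨hz₃, h8₃, h6₃, h200₃, hα₃, hΨ₃, -, -⟩ := hreg X₃ (hE₁'.trans (hX₃'.trans hX₃'X)) hX₃x
  rw [max_le_iff] at hz₁ hz₂ hz₃
  have hx₁0 : 0 < x₁ := by linarith [hz₁.2]
  have hx₂0 : 0 < x₂ := by linarith [hz₂.2]
  have hX₃0 : 0 < X₃ := by linarith [hz₃.2]
  -- the third mask: indicator of the box-and-class set `A`
  set A : Finset ℕ := (Nat.smoothNumbersUpTo ⌊X₃⌋₊ (y + 1) \ Nat.smoothNumbersUpTo ⌊X₃'⌋₊ (y + 1)).filter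
    (fun n => n ≡ c [MOD m]) with hA
  have hAS : A ⊆ Nat.smoothNumbersUpTo ⌊X₃⌋₊ (y + 1) :=
    (Finset.filter_subset _ _).trans Finset.sdiff_subset
  set a₃ : ℕ → ℂ := fun n => if n ∈ A then (1 : ℂ) else 0 with ha₃
  have ha₃1 : ∀ n, ‖a₃ n‖ ≤ 1 := by
    intro n
    simp only [ha₃]
    split_ifs <;> simp
  have hident : ∀ θ : ℝ, ∑ n ∈ Nat.smoothNumbersUpTo ⌊X₃⌋₊ (y + 1), a₃ n * (𝐞 ((n : ℝ) * θ) : ℂ) =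
      ∑ n ∈ A, (𝐞 ((n : ℝ) * θ) : ℂ) := fun θ => sum_indicator_mul_eq hAS _
  -- the dilation as a natural number and the pointwise bound `S₃`
  have hd₃0 : 0 ≤ d₃ := by omega
  have hdnat : ((d₃.toNat : ℕ) : ℝ) = (d₃ : ℝ) := by
    have h : ((d₃.toNat : ℕ) : ℤ) = d₃ := Int.toNat_of_nonneg hd₃0
    exact_mod_cast congrArg (fun z : ℤ => (z : ℝ)) h
  have hd₃1' : 1 ≤ d₃.toNat := by omega
  set P₃ : ℝ := X₃ ^ saddlePoint X₃ y *
    (smoothZeta (saddlePoint X₃ y) y / Real.sqrt (saddlePhi₂ (saddlePoint X₃ y) y)) with hP₃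
  have hP₃0 : 0 ≤ P₃ := by
    have : 0 < smoothZeta (saddlePoint X₃ y) y := smoothZeta_pos (by linarith)
    positivity
  set t : ℝ := (d₃ : ℝ) * L ^ B / R with ht
  have hd₃r : (1 : ℝ) ≤ d₃ := by exact_mod_cast hd₃1
  have hR0 : 0 < R := lt_of_lt_of_le (by positivity) hR
  have ht0 : 0 ≤ t := by positivity
  set S₃ : ℝ := C₁ * L ^ 28 * t ^ (49 / 100 : ℝ) * P₃ with hS₃
  have hS₃0 : 0 ≤ S₃ := by positivity
  have hsup : ∀ r ∈ T, ‖∑ n ∈ Nat.smoothNumbersUpTo ⌊X₃⌋₊ (y + 1),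
      a₃ n * (𝐞 ((n : ℝ) * ((d₃ * r : ℝ) / N₀)) : ℂ)‖ ≤ S₃ := by
    intro r hr
    rw [hident]
    have key := hMx X₃ X₃' hX₃' hX₃'X hX₃x d₃.toNat hd₃1' R (by rw [hdnat]; exact hR) hRx ((r : ℝ) / N₀)
      (hminor r hr) m c hm
    have hph : ∀ n : ℕ, (n : ℝ) * (((d₃.toNat : ℕ) : ℝ) * ((r : ℝ) / N₀)) = (n : ℝ) * ((d₃ * r : ℝ) / N₀) := by
      intro n; rw [hdnat]; ring
    simp only [hph] at key
    rw [hdnat] at key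
    exact key
  -- Hölder–restriction with multiplicity
  have hmain := hT y x₁ x₂ X₃ hz₁.1 h8₁ h6₁ h200₁ hα₁ hΨ₁ hz₂.1 h8₂ h6₂ h200₂ hα₂ hΨ₂ hz₃.1 h8₃ h6₃ h200₃ hα₃
    hΨ₃ N₀ hN₀ g₁ N₁ g₂ N₂ hgN₁ hgN₂ d₁ d₁' d₂ d₂' d₃ hd₁ hd₁' hd₂ hd₂' hd₃ a₁ a₂ a₃ ha₁ ha₂ ha₃1 T hTN S₃
    hS₃0 hsup
  simp only [hident] at hmain
  refine hmain.trans ?_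
  -- ### bookkeeping of the right-hand side
  have hP0 : ∀ Z : ℝ, 0 < Z → 1 - 1 / 10000 ≤ saddlePoint Z y →
      0 ≤ Z ^ saddlePoint Z y * (smoothZeta (saddlePoint Z y) y / Real.sqrt (saddlePhi₂ (saddlePoint Z y) y)) := by
    intro Z hZ hα
    have : 0 < smoothZeta (saddlePoint Z y) y := smoothZeta_pos (by linarith)
    positivity
  have hlog1 : ∀ {Z : ℝ}, 1 ≤ Z → Z ≤ x → 0 ≤ Real.log Z ∧ Real.log Z ≤ L := fun hZ hZx =>
    ⟨Real.log_nonneg hZ, Real.log_le_log (by linarith) hZx⟩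
  obtain ⟨hl₁0, hl₁⟩ := hlog1 hz₁.2 hx₁x
  obtain ⟨hl₂0, hl₂⟩ := hlog1 hz₂.2 hx₂x
  obtain ⟨hl₃0, hl₃⟩ := hlog1 hz₃.2 hX₃x
  have hlog8 := log_prod_pow_le hl₁0 hl₂0 hl₃0 hl₁ hl₂ hl₃
  have hsq : P₃ ^ (1 / 2 : ℝ) * S₃ ^ (1 / 2 : ℝ) = Real.sqrt C₁ * L ^ 14 * t ^ (49 / 200 : ℝ) * P₃ :=
    sqrt_saving_eq hC₁.le hL0.le ht0 hP₃0
  set O₁ : ℝ := ((g₁ : ℝ) * (1 + (N₁ : ℝ) / x₁)) ^ (2 / 5 : ℝ) with hO₁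
  set O₂ : ℝ := ((g₂ : ℝ) * (1 + (N₂ : ℝ) / x₂)) ^ (2 / 5 : ℝ) with hO₂
  set O₃ : ℝ := (1 + (N₀ : ℝ) / X₃) ^ (1 / 5 : ℝ) with hO₃
  set P₁ : ℝ := x₁ ^ saddlePoint x₁ y *
    (smoothZeta (saddlePoint x₁ y) y / Real.sqrt (saddlePhi₂ (saddlePoint x₁ y) y)) with hP₁
  set P₂ : ℝ := x₂ ^ saddlePoint x₂ y *
    (smoothZeta (saddlePoint x₂ y) y / Real.sqrt (saddlePhi₂ (saddlePoint x₂ y) y)) with hP₂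
  have hrest : 0 ≤ O₁ * O₂ * O₃ * P₁ * P₂ * (Real.sqrt C₁ * L ^ 14 * t ^ (49 / 200 : ℝ) * P₃) := by
    have := hP0 x₁ hx₁0 hα₁
    have := hP0 x₂ hx₂0 hα₂
    positivity
  calc C₂ * (Real.log x₁ * Real.log x₂ * Real.log X₃) ^ (8 : ℕ) * O₁ * O₂ * O₃ * P₁ * P₂ *
        P₃ ^ (1 / 2 : ℝ) * S₃ ^ (1 / 2 : ℝ)
      = C₂ * (Real.log x₁ * Real.log x₂ * Real.log X₃) ^ (8 : ℕ) *
          (O₁ * O₂ * O₃ * P₁ * P₂ * (P₃ ^ (1 / 2 : ℝ) * S₃ ^ (1 / 2 : ℝ))) := by ring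
    _ = C₂ * (Real.log x₁ * Real.log x₂ * Real.log X₃) ^ (8 : ℕ) *
          (O₁ * O₂ * O₃ * P₁ * P₂ * (Real.sqrt C₁ * L ^ 14 * t ^ (49 / 200 : ℝ) * P₃)) := by rw [hsq]
    _ ≤ C₂ * L ^ 24 * (O₁ * O₂ * O₃ * P₁ * P₂ * (Real.sqrt C₁ * L ^ 14 * t ^ (49 / 200 : ℝ) * P₃)) := by
        apply mul_le_mul_of_nonneg_right _ hrest
        exact mul_le_mul_of_nonneg_left hlog8 hC₂.le
    _ = C₂ * Real.sqrt C₁ * L ^ 38 * t ^ (49 / 200 : ℝ) * O₁ * O₂ * O₃ * P₁ * P₂ * P₃ := by ring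

end SharpMinor

end Literature.NumberTheory.Sieve

end
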